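import Mathlib
import HarnessLib

/-!
# Cell pnp-psdrank, route `ChebyshevTracialDesign`: real-arithmetic tools for the RELATIVE form of the centred second moment's
# level-smoothness sum — the `k = 1` half and the two floors (crux `TracialDecayExp20`, stmt-PneNP-19878)

Brick 139b (prover g28; MEMO-30 rev 3 §3b/§4). Companion of `…SecondMomentRelativeOrders`. Brick 138's `½·FIRST` is explicit in `A = A^m_1(x)`,
the factorial sections `F² = E_1[1_x n_A(n_A−1)]`, `F¹ = E_1[1_x n_A]`, `|B^m_3(x)|`, `law_3(x)`, the level-`1` `x`-smoothness constants `E`, `Far`,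
the pair density `PF = (|vAA||vDD| + Σ_{vBH}(|vBN|−1))/(n(n−2))` and `R = n(n−2)/((2r+6)(n−2r−8))`. Pure real arithmetic (no shells):

* §1 **`first_half_le`** (+ the bookkeeping identity `first_half_identity`): with `0 ≤ PF ≤ ½`, `F² ≤ a²·law`, `F¹ ≤ a·law`, `0 ≤ m ≤ a`,
  `|B^m_3| ≤ a·law·(4Γq + (2+4Γq)/(2r+6)) + (16a/3)τ` and `law_3 ≤ (1+2Γq)·law + (8/3)τ`: `½·FIRST ≤ (E·R/4 + 1/(r+1))·A + λ₁·law + μ₁·τ + φ·Far`,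
  all coefficients explicit in `r, a, E, R, Γq` (the statement keeps brick 138's literal casts on the left so that it applies by `exact`).
* §2 small atoms: `natCast_mul_sub_one_le_sq` (`n_A(n_A−1) ≤ a²`; nonnegativity is the tree's `LubyRackoff.cast_mul_pred_nonneg`) and **`b3_bound_of`** (brick 133 at `k = 1` + the `k = 1` budgets
  + the level-`1` comparison `G₁(0) ≤ (n/T)·a·law` + `|m| ≤ a` ⇒ the `|B^m_3|` bound above).
* §3 **`rel_of_floor`**: `α·A + λ·law + μ' ≤ (α + λ/V + μ'/(LB·V))·A` under the variance floor `V·law ≤ A` and the window floor `LB ≤ law`.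
WHAT THIS FILE DOES NOT DO: anything about shells, (V) or LB themselves, the numerics `ε_A → 0`, `TracialDecayExp20` itself, psd rank of
P_PM(K_n), or P vs NP. [cite: Rothvoss2017, §2 (PDF p. 6)] [cite: RollinRoss2010, §4.1 Thm 4.2] [cite: Boole2009, Ch. II Art. 10 Ex. 3 eq. (8)]
Stature: support/instrument (kernel lane, no defs, axioms standard; pure bookkeeping). Supports stmt-PneNP-19878.
-/

set_option linter.dupNamespace false -- `Summit.PneNP.PneNP.…`: summit = sub-problem (D-0017)

noncomputable section

namespace Summit.PneNP.PneNP.Theorems.ChebyshevTracialDesignGammaDirectionSecondMomentRelativeFirst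

open Finset

/-! ### §1 The `k = 1` half of brick 138 in four-term form -/

/-- The bookkeeping identity behind `first_half_le` (collecting the `A`, `law`, `τ`, `Far` coefficients). [cite: Rothvoss2017, §2 (PDF p. 6)] -/
theorem first_half_identity (r a : ℕ) (E Rr A law Far τ Γ q : ℝ) :
    (1 / 2 : ℝ) * (1 / 2 * (E * Rr * (A + 2 / ((r : ℝ) + 1) * ((a : ℝ) ^ 2 * law) +
        1 / ((r : ℝ) + 2) * ((2 * (a : ℝ) + 1) * ((a : ℝ) * law))) +
        ((((r : ℝ) + 2) + a) ^ 2 * Far + 2 / ((r : ℝ) + 1) * (((r : ℝ) + 2) ^ 2 * Far) +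
          (2 * (a : ℝ) + 1) * Far)) +
        2 / ((r : ℝ) + 1) * A +
        (2 * (a : ℝ) + 1) * (((r : ℝ) + 3) / (((r : ℝ) + 2) * ((r : ℝ) + 1))) *
          ((a : ℝ) * law * (4 * Γ * q + (2 + 4 * Γ * q) / (2 * (r : ℝ) + 6)) + 16 * (a : ℝ) / 3 * τ) +
        (a : ℝ) * (2 * (a : ℝ) + r + 3) / (((r : ℝ) + 2) * ((r : ℝ) + 1)) * ((1 + 2 * Γ * q) * law + 8 / 3 * τ)) =
      (E * Rr / 4 + 1 / ((r : ℝ) + 1)) * A +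
        (E * Rr / 4 * (2 * (a : ℝ) ^ 2 / ((r : ℝ) + 1) + (2 * (a : ℝ) + 1) * a / ((r : ℝ) + 2)) +
            (2 * (a : ℝ) + 1) * ((r : ℝ) + 3) / (2 * ((r : ℝ) + 2) * ((r : ℝ) + 1)) *
              ((a : ℝ) * (4 * Γ * q + (2 + 4 * Γ * q) / (2 * (r : ℝ) + 6))) +
            (a : ℝ) * (2 * (a : ℝ) + r + 3) / (2 * ((r : ℝ) + 2) * ((r : ℝ) + 1)) * (1 + 2 * Γ * q)) * law +
        ((2 * (a : ℝ) + 1) * ((r : ℝ) + 3) / (2 * ((r : ℝ) + 2) * ((r : ℝ) + 1)) * (16 * (a : ℝ) / 3) +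
            (a : ℝ) * (2 * (a : ℝ) + r + 3) / (2 * ((r : ℝ) + 2) * ((r : ℝ) + 1)) * (8 / 3)) * τ +
        ((((r : ℝ) + 2 + a) ^ 2 + 2 * ((r : ℝ) + 2) ^ 2 / ((r : ℝ) + 1) + (2 * (a : ℝ) + 1)) / 4) * Far := by
  simp only [← div_div]
  ring

/-- **The `k = 1` half, four-term form.** With the pair density `0 ≤ PF ≤ ½`, `E, A, F², F¹, Far, law, τ, Γ, q ≥ 0`, `F² ≤ a²·law`,
`F¹ ≤ a·law`, `0 ≤ m ≤ a`, `2r+10 ≤ ν` (`ν = n`), the brick-133 bound `|B^m_3| ≤ a·law·(4Γq + (2+4Γq)/(2r+6)) + (16a/3)τ` and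
`law_3 ≤ (1+2Γq)law + (8/3)τ`, the `½·FIRST` of brick 138 (written with its literal casts, cut `2r+1+6`, base level `1`) is at most
`(E·R/4 + 1/(r+1))·A + λ₁·law + μ₁·τ + φ·Far`, `R = ν(ν−2)/((2r+6)(ν−2r−8))`,
`λ₁ = (E R/4)(2a²/(r+1) + (2a+1)a/(r+2)) + ((2a+1)(r+3)/(2(r+2)(r+1)))·a(4Γq + (2+4Γq)/(2r+6)) + (a(2a+r+3)/(2(r+2)(r+1)))(1+2Γq)`,
`μ₁ = ((2a+1)(r+3)/(2(r+2)(r+1)))(16a/3) + (a(2a+r+3)/(2(r+2)(r+1)))(8/3)`, `φ = ((r+2+a)² + 2(r+2)²/(r+1) + (2a+1))/4`.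
[cite: Rothvoss2017, §2 (PDF p. 6)] [cite: RollinRoss2010, §4.1 Thm 4.2] -/
theorem first_half_le (r a : ℕ) (ν PF E A F2 F1 B3 law law3 Far τ Γ q m : ℝ)
    (hPF0 : 0 ≤ PF) (hPF : PF ≤ 1 / 2) (hE : 0 ≤ E) (hA : 0 ≤ A) (hF2 : 0 ≤ F2) (hF1 : 0 ≤ F1) (hFar : 0 ≤ Far)
    (hlaw : 0 ≤ law) (hτ : 0 ≤ τ) (hΓ : 0 ≤ Γ) (hq0 : 0 ≤ q) (hν : 2 * (r : ℝ) + 10 ≤ ν)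
    (hF2a : F2 ≤ (a : ℝ) ^ 2 * law) (hF1a : F1 ≤ (a : ℝ) * law) (hm0 : 0 ≤ m) (hma : m ≤ a)
    (hB3 : B3 ≤ (a : ℝ) * law * (4 * Γ * q + (2 + 4 * Γ * q) / (2 * (r : ℝ) + 6)) + 16 * (a : ℝ) / 3 * τ)
    (hlaw3 : law3 ≤ (1 + 2 * Γ * q) * law + 8 / 3 * τ) :
    (1 / 2 : ℝ) *
        (PF * (E * ((ν * (ν - 2)) /
                (((((2 * r + 1 : ℕ) : ℕ) : ℝ) + 6 - ((1 : ℕ) : ℝ)) * (ν - (((2 * r + 1 : ℕ) : ℕ) + 6) - ((1 : ℕ) : ℝ)))) *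
              (A + (((((2 * r + 1 : ℕ) : ℕ) : ℝ) + 6 - ((1 : ℕ) : ℝ)) / ((((2 * r + 1 : ℕ) : ℕ) : ℝ) + 2 - ((1 : ℕ) : ℝ)) - 1) * F2 +
                (((((2 * r + 1 : ℕ) : ℕ) : ℝ) + 6 - ((1 : ℕ) : ℝ)) / ((((2 * r + 1 : ℕ) : ℕ) : ℝ) + 4 - ((1 : ℕ) : ℝ)) - 1) * |1 - 2 * m| * F1) +
            ((((r : ℝ) + 2) + |m|) ^ 2 * Far +
              (((((2 * r + 1 : ℕ) : ℕ) : ℝ) + 6 - ((1 : ℕ) : ℝ)) / ((((2 * r + 1 : ℕ) : ℕ) : ℝ) + 2 - ((1 : ℕ) : ℝ)) - 1) *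
                (((r : ℝ) + 2) ^ 2 * Far) +
              (((((2 * r + 1 : ℕ) : ℕ) : ℝ) + 6 - ((1 : ℕ) : ℝ)) / ((((2 * r + 1 : ℕ) : ℕ) : ℝ) + 4 - ((1 : ℕ) : ℝ)) - 1) * |1 - 2 * m| *
                (((r : ℝ) + 2) * Far))) +
          (4 / ((((2 * r + 1 : ℕ) : ℕ) : ℝ) + 2 - ((1 : ℕ) : ℝ))) * A +
          abs (2 * m - 1) * (2 * ((((2 * r + 1 : ℕ) : ℕ) : ℝ) + 6 - ((1 : ℕ) : ℝ)) /
              (((((2 * r + 1 : ℕ) : ℕ) : ℝ) + 4 - ((1 : ℕ) : ℝ)) * ((((2 * r + 1 : ℕ) : ℕ) : ℝ) + 2 - ((1 : ℕ) : ℝ)))) * B3 +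
          (abs (2 * m * (4 * m + ((1 : ℕ) : ℝ) - ((2 * r + 1 : ℕ) : ℕ) - 6)) /
              (((((2 * r + 1 : ℕ) : ℕ) : ℝ) + 4 - ((1 : ℕ) : ℝ)) * ((((2 * r + 1 : ℕ) : ℕ) : ℝ) + 2 - ((1 : ℕ) : ℝ)))) * law3) ≤
      (E * (ν * (ν - 2) / ((2 * (r : ℝ) + 6) * (ν - 2 * r - 8))) / 4 + 1 / ((r : ℝ) + 1)) * A +
        (E * (ν * (ν - 2) / ((2 * (r : ℝ) + 6) * (ν - 2 * r - 8))) / 4 *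
              (2 * (a : ℝ) ^ 2 / ((r : ℝ) + 1) + (2 * (a : ℝ) + 1) * a / ((r : ℝ) + 2)) +
            (2 * (a : ℝ) + 1) * ((r : ℝ) + 3) / (2 * ((r : ℝ) + 2) * ((r : ℝ) + 1)) *
              ((a : ℝ) * (4 * Γ * q + (2 + 4 * Γ * q) / (2 * (r : ℝ) + 6))) +
            (a : ℝ) * (2 * (a : ℝ) + r + 3) / (2 * ((r : ℝ) + 2) * ((r : ℝ) + 1)) * (1 + 2 * Γ * q)) * law +
        ((2 * (a : ℝ) + 1) * ((r : ℝ) + 3) / (2 * ((r : ℝ) + 2) * ((r : ℝ) + 1)) * (16 * (a : ℝ) / 3) +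
            (a : ℝ) * (2 * (a : ℝ) + r + 3) / (2 * ((r : ℝ) + 2) * ((r : ℝ) + 1)) * (8 / 3)) * τ +
        ((((r : ℝ) + 2 + a) ^ 2 + 2 * ((r : ℝ) + 2) ^ 2 / ((r : ℝ) + 1) + (2 * (a : ℝ) + 1)) / 4) * Far := by
  -- clean the casts
  have e6 : (((2 * r + 1 : ℕ) : ℕ) : ℝ) + 6 - ((1 : ℕ) : ℝ) = 2 * (r : ℝ) + 6 := by push_cast; ring
  have e2 : (((2 * r + 1 : ℕ) : ℕ) : ℝ) + 2 - ((1 : ℕ) : ℝ) = 2 * (r : ℝ) + 2 := by push_cast; ring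
  have e4 : (((2 * r + 1 : ℕ) : ℕ) : ℝ) + 4 - ((1 : ℕ) : ℝ) = 2 * (r : ℝ) + 4 := by push_cast; ring
  have eR : ν - (((2 * r + 1 : ℕ) : ℕ) + 6) - ((1 : ℕ) : ℝ) = ν - 2 * r - 8 := by push_cast; ring
  have eL : abs (2 * m * (4 * m + ((1 : ℕ) : ℝ) - ((2 * r + 1 : ℕ) : ℕ) - 6)) = |2 * m * (4 * m - 2 * r - 6)| := by
    push_cast; ring_nf
  rw [e6, e2, e4, eR, eL]
  -- the basic quantities
  have hr0 : (0 : ℝ) ≤ r := Nat.cast_nonneg r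
  have ha0 : (0 : ℝ) ≤ a := Nat.cast_nonneg a
  obtain ⟨Rr, hRr⟩ : ∃ e : ℝ, e = ν * (ν - 2) / ((2 * (r : ℝ) + 6) * (ν - 2 * r - 8)) := ⟨_, rfl⟩
  rw [← hRr]
  have hRr0 : 0 ≤ Rr := by
    rw [hRr]
    apply div_nonneg (mul_nonneg (by linarith) (by linarith)) (mul_nonneg (by linarith) (by linarith))
  have hθ₂ : (2 * (r : ℝ) + 6) / (2 * (r : ℝ) + 2) - 1 = 2 / ((r : ℝ) + 1) := by
    field_simp; ring
  have hθ₁ : (2 * (r : ℝ) + 6) / (2 * (r : ℝ) + 4) - 1 = 1 / ((r : ℝ) + 2) := by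
    field_simp; ring
  have hc4 : (4 : ℝ) / (2 * (r : ℝ) + 2) = 2 / ((r : ℝ) + 1) := by
    field_simp; ring
  have hcB : 2 * (2 * (r : ℝ) + 6) / ((2 * (r : ℝ) + 4) * (2 * (r : ℝ) + 2)) = ((r : ℝ) + 3) / (((r : ℝ) + 2) * ((r : ℝ) + 1)) := by
    field_simp; ring
  rw [hθ₂, hθ₁, hc4, hcB]
  have hθ₂0 : (0 : ℝ) ≤ 2 / ((r : ℝ) + 1) := by positivity
  have hθ₁0 : (0 : ℝ) ≤ 1 / ((r : ℝ) + 2) := by positivity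
  -- absolute values of the centring
  have habs1 : |1 - 2 * m| ≤ 2 * (a : ℝ) + 1 := by
    rw [abs_le]; constructor <;> linarith
  have habs2 : |2 * m - 1| ≤ 2 * (a : ℝ) + 1 := by
    rw [abs_le]; constructor <;> linarith
  have habsm : |m| = m := abs_of_nonneg hm0
  rw [habsm]
  have habsL : |2 * m * (4 * m - 2 * r - 6)| ≤ 4 * ((a : ℝ) * (2 * (a : ℝ) + r + 3)) := by
    rw [abs_mul, abs_of_nonneg (by linarith : (0 : ℝ) ≤ 2 * m)]
    have h1 : |4 * m - 2 * (r : ℝ) - 6| ≤ 4 * m + 2 * r + 6 := by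
      rw [abs_le]; constructor <;> linarith
    have h2 : 2 * m * |4 * m - 2 * (r : ℝ) - 6| ≤ 2 * m * (4 * m + 2 * r + 6) :=
      mul_le_mul_of_nonneg_left h1 (by linarith)
    have h3 : m * m ≤ (a : ℝ) * a := mul_le_mul hma hma hm0 ha0
    have h4 : m * (r : ℝ) ≤ (a : ℝ) * r := mul_le_mul_of_nonneg_right hma hr0
    calc 2 * m * |4 * m - 2 * (r : ℝ) - 6| ≤ 2 * m * (4 * m + 2 * r + 6) := h2
      _ = 8 * (m * m) + 4 * (m * (r : ℝ)) + 12 * m := by ring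
      _ ≤ 8 * ((a : ℝ) * a) + 4 * ((a : ℝ) * r) + 12 * (a : ℝ) := by linarith
      _ = 4 * ((a : ℝ) * (2 * (a : ℝ) + r + 3)) := by ring
  -- piece 1: the pair/`x`-smoothness block
  have hX : E * Rr * (A + 2 / ((r : ℝ) + 1) * F2 + 1 / ((r : ℝ) + 2) * |1 - 2 * m| * F1) +
        ((((r : ℝ) + 2) + m) ^ 2 * Far + 2 / ((r : ℝ) + 1) * (((r : ℝ) + 2) ^ 2 * Far) +
          1 / ((r : ℝ) + 2) * |1 - 2 * m| * (((r : ℝ) + 2) * Far)) ≤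
      E * Rr * (A + 2 / ((r : ℝ) + 1) * ((a : ℝ) ^ 2 * law) + 1 / ((r : ℝ) + 2) * ((2 * (a : ℝ) + 1) * ((a : ℝ) * law))) +
        ((((r : ℝ) + 2) + a) ^ 2 * Far + 2 / ((r : ℝ) + 1) * (((r : ℝ) + 2) ^ 2 * Far) +
          (2 * (a : ℝ) + 1) * Far) := by
    have h1 : |1 - 2 * m| * F1 ≤ (2 * (a : ℝ) + 1) * ((a : ℝ) * law) :=
      mul_le_mul habs1 hF1a hF1 (by positivity)
    have h2 : E * Rr * (A + 2 / ((r : ℝ) + 1) * F2 + 1 / ((r : ℝ) + 2) * |1 - 2 * m| * F1) ≤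
        E * Rr * (A + 2 / ((r : ℝ) + 1) * ((a : ℝ) ^ 2 * law) + 1 / ((r : ℝ) + 2) * ((2 * (a : ℝ) + 1) * ((a : ℝ) * law))) := by
      apply mul_le_mul_of_nonneg_left _ (mul_nonneg hE hRr0)
      have h3 : 2 / ((r : ℝ) + 1) * F2 ≤ 2 / ((r : ℝ) + 1) * ((a : ℝ) ^ 2 * law) := mul_le_mul_of_nonneg_left hF2a hθ₂0
      have h4 : 1 / ((r : ℝ) + 2) * |1 - 2 * m| * F1 ≤ 1 / ((r : ℝ) + 2) * ((2 * (a : ℝ) + 1) * ((a : ℝ) * law)) := by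
        rw [mul_assoc]; exact mul_le_mul_of_nonneg_left h1 hθ₁0
      linarith
    have h5 : (((r : ℝ) + 2) + m) ^ 2 * Far ≤ (((r : ℝ) + 2) + a) ^ 2 * Far := by
      apply mul_le_mul_of_nonneg_right _ hFar
      exact pow_le_pow_left₀ (by linarith) (by linarith) 2
    have h6 : 1 / ((r : ℝ) + 2) * |1 - 2 * m| * (((r : ℝ) + 2) * Far) ≤
        (2 * (a : ℝ) + 1) * Far := by
      have h7 : 1 / ((r : ℝ) + 2) * |1 - 2 * m| * (((r : ℝ) + 2) * Far) ≤
          1 / ((r : ℝ) + 2) * (2 * (a : ℝ) + 1) * (((r : ℝ) + 2) * Far) := by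
        apply mul_le_mul_of_nonneg_right _ (by positivity)
        exact mul_le_mul_of_nonneg_left habs1 hθ₁0
      have h8 : 1 / ((r : ℝ) + 2) * (2 * (a : ℝ) + 1) * (((r : ℝ) + 2) * Far) = (2 * (a : ℝ) + 1) * Far := by
        have hr2 : (r : ℝ) + 2 ≠ 0 := by positivity
        field_simp
      linarith
    linarith
  have hX0 : 0 ≤ E * Rr * (A + 2 / ((r : ℝ) + 1) * F2 + 1 / ((r : ℝ) + 2) * |1 - 2 * m| * F1) +
        ((((r : ℝ) + 2) + m) ^ 2 * Far + 2 / ((r : ℝ) + 1) * (((r : ℝ) + 2) ^ 2 * Far) +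
          1 / ((r : ℝ) + 2) * |1 - 2 * m| * (((r : ℝ) + 2) * Far)) := by positivity
  have hP1 : PF * (E * Rr * (A + 2 / ((r : ℝ) + 1) * F2 + 1 / ((r : ℝ) + 2) * |1 - 2 * m| * F1) +
        ((((r : ℝ) + 2) + m) ^ 2 * Far + 2 / ((r : ℝ) + 1) * (((r : ℝ) + 2) ^ 2 * Far) +
          1 / ((r : ℝ) + 2) * |1 - 2 * m| * (((r : ℝ) + 2) * Far))) ≤
      1 / 2 * (E * Rr * (A + 2 / ((r : ℝ) + 1) * ((a : ℝ) ^ 2 * law) + 1 / ((r : ℝ) + 2) * ((2 * (a : ℝ) + 1) * ((a : ℝ) * law))) +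
        ((((r : ℝ) + 2) + a) ^ 2 * Far + 2 / ((r : ℝ) + 1) * (((r : ℝ) + 2) ^ 2 * Far) +
          (2 * (a : ℝ) + 1) * Far)) := by
    calc _ ≤ PF * (E * Rr * (A + 2 / ((r : ℝ) + 1) * ((a : ℝ) ^ 2 * law) + 1 / ((r : ℝ) + 2) * ((2 * (a : ℝ) + 1) * ((a : ℝ) * law))) +
        ((((r : ℝ) + 2) + a) ^ 2 * Far + 2 / ((r : ℝ) + 1) * (((r : ℝ) + 2) ^ 2 * Far) +
          (2 * (a : ℝ) + 1) * Far)) := mul_le_mul_of_nonneg_left hX hPF0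
      _ ≤ _ := mul_le_mul_of_nonneg_right hPF (hX0.trans hX)
  -- piece 3: the `B^m_3` term
  have hB30 : 0 ≤ (a : ℝ) * law * (4 * Γ * q + (2 + 4 * Γ * q) / (2 * (r : ℝ) + 6)) + 16 * (a : ℝ) / 3 * τ := by positivity
  have hP3 : |2 * m - 1| * (((r : ℝ) + 3) / (((r : ℝ) + 2) * ((r : ℝ) + 1))) * B3 ≤
      (2 * (a : ℝ) + 1) * (((r : ℝ) + 3) / (((r : ℝ) + 2) * ((r : ℝ) + 1))) *
        ((a : ℝ) * law * (4 * Γ * q + (2 + 4 * Γ * q) / (2 * (r : ℝ) + 6)) + 16 * (a : ℝ) / 3 * τ) := by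
    have hc0 : (0 : ℝ) ≤ ((r : ℝ) + 3) / (((r : ℝ) + 2) * ((r : ℝ) + 1)) := by positivity
    calc |2 * m - 1| * (((r : ℝ) + 3) / (((r : ℝ) + 2) * ((r : ℝ) + 1))) * B3
        ≤ |2 * m - 1| * (((r : ℝ) + 3) / (((r : ℝ) + 2) * ((r : ℝ) + 1))) *
          ((a : ℝ) * law * (4 * Γ * q + (2 + 4 * Γ * q) / (2 * (r : ℝ) + 6)) + 16 * (a : ℝ) / 3 * τ) :=
          mul_le_mul_of_nonneg_left hB3 (mul_nonneg (abs_nonneg _) hc0)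
      _ ≤ _ := by
          apply mul_le_mul_of_nonneg_right _ hB30
          exact mul_le_mul_of_nonneg_right habs2 hc0
  -- piece 4: the `law_3` term
  have hlaw30 : 0 ≤ (1 + 2 * Γ * q) * law + 8 / 3 * τ := by positivity
  have hP4 : |2 * m * (4 * m - 2 * r - 6)| / ((2 * (r : ℝ) + 4) * (2 * (r : ℝ) + 2)) * law3 ≤
      4 * ((a : ℝ) * (2 * (a : ℝ) + r + 3)) / ((2 * (r : ℝ) + 4) * (2 * (r : ℝ) + 2)) * ((1 + 2 * Γ * q) * law + 8 / 3 * τ) := by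
    have hd0 : (0 : ℝ) < (2 * (r : ℝ) + 4) * (2 * (r : ℝ) + 2) := by positivity
    calc |2 * m * (4 * m - 2 * r - 6)| / ((2 * (r : ℝ) + 4) * (2 * (r : ℝ) + 2)) * law3
        ≤ |2 * m * (4 * m - 2 * r - 6)| / ((2 * (r : ℝ) + 4) * (2 * (r : ℝ) + 2)) * ((1 + 2 * Γ * q) * law + 8 / 3 * τ) :=
          mul_le_mul_of_nonneg_left hlaw3 (div_nonneg (abs_nonneg _) hd0.le)
      _ ≤ _ := by
          apply mul_le_mul_of_nonneg_right _ hlaw30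
          exact div_le_div_of_nonneg_right habsL hd0.le
  have hcL : 4 * ((a : ℝ) * (2 * (a : ℝ) + r + 3)) / ((2 * (r : ℝ) + 4) * (2 * (r : ℝ) + 2)) =
      (a : ℝ) * (2 * (a : ℝ) + r + 3) / (((r : ℝ) + 2) * ((r : ℝ) + 1)) := by
    field_simp; ring
  rw [hcL] at hP4
  -- assemble (pure linear arithmetic in the pieces)
  rw [← first_half_identity r a E Rr A law Far τ Γ q]
  apply mul_le_mul_of_nonneg_left _ (by norm_num : (0 : ℝ) ≤ 1 / 2)
  exact add_le_add (add_le_add (add_le_add hP1 le_rfl) hP3) hP4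

/-! ### §2 Small atoms of the shell instance -/

/-- `c(c−1) ≤ a²` for naturals `c ≤ a` (cast to `ℝ`). [cite: Rothvoss2017, §2 (PDF p. 6)] -/
theorem natCast_mul_sub_one_le_sq {c a : ℕ} (hca : c ≤ a) : (c : ℝ) * ((c : ℝ) - 1) ≤ (a : ℝ) ^ 2 := by
  have h1 : (c : ℝ) ≤ a := by exact_mod_cast hca
  have h0 : (0 : ℝ) ≤ c := Nat.cast_nonneg c
  nlinarith

/-- **The `|B^m_3|` atom**: brick 133 at `k = 1` reads `|B^m_3| ≤ (T/ν)|ΔG₁(0)| + (2/ν)(|G₁(0)| + |ΔG₁(0)|) + |m|·|ΔG₀(0)|`; with the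
`k = 1` budgets `|ΔG₁(0)| ≤ 2(Γq G₁(0) + a(4/3)τ)`, `|ΔG₀(0)| ≤ 2(Γq·law + (4/3)τ)`, the level-`1` comparison `G₁(0) ≤ (ν/T)·a·law`,
`|m| ≤ a` and `T + 2 ≤ ν`: `|B^m_3| ≤ a·law·(4Γq + (2+4Γq)/T) + (16a/3)τ`. [cite: Rothvoss2017, §2 (PDF p. 6)]
[cite: Boole2009, Ch. II Art. 10 Ex. 3 eq. (8)] -/
theorem b3_bound_of {T ν a ma Γ q τ law G₁ dG₁ dG₀ : ℝ} (hT : 0 < T) (hν : 0 < ν) (hTν : T + 2 ≤ ν) (ha : 0 ≤ a)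
    (hma0 : 0 ≤ ma) (hma : ma ≤ a) (hΓ : 0 ≤ Γ) (hq : 0 ≤ q) (hτ : 0 ≤ τ) (hlaw : 0 ≤ law)
    (hG₁ : G₁ ≤ ν / T * (a * law)) (hdG₁ : dG₁ ≤ 2 * (Γ * q * G₁ + a * ((4 / 3 : ℝ) * τ)))
    (hdG₀ : dG₀ ≤ 2 * (Γ * q * law + (4 / 3 : ℝ) * τ)) :
    T / ν * dG₁ + 2 / ν * (G₁ + dG₁) + ma * dG₀ ≤
      a * law * (4 * Γ * q + (2 + 4 * Γ * q) / T) + 16 * a / 3 * τ := by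
  have hTν0 : 0 ≤ T / ν := div_nonneg hT.le hν.le
  have h2ν0 : (0 : ℝ) ≤ 2 / ν := div_nonneg (by norm_num) hν.le
  have hdG₁' : dG₁ ≤ 2 * (Γ * q * (ν / T * (a * law)) + a * ((4 / 3 : ℝ) * τ)) := by
    have := mul_le_mul_of_nonneg_left hG₁ (mul_nonneg hΓ hq)
    linarith
  have p1 : T / ν * dG₁ ≤ T / ν * (2 * (Γ * q * (ν / T * (a * law)) + a * ((4 / 3 : ℝ) * τ))) :=
    mul_le_mul_of_nonneg_left hdG₁' hTν0
  have p2 : 2 / ν * (G₁ + dG₁) ≤ 2 / ν * (ν / T * (a * law) + 2 * (Γ * q * (ν / T * (a * law)) + a * ((4 / 3 : ℝ) * τ))) :=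
    mul_le_mul_of_nonneg_left (by linarith) h2ν0
  have p3 : ma * dG₀ ≤ a * (2 * (Γ * q * law + (4 / 3 : ℝ) * τ)) :=
    (mul_le_mul_of_nonneg_left hdG₀ hma0).trans (mul_le_mul_of_nonneg_right hma (by positivity))
  have e1 : T / ν * (2 * (Γ * q * (ν / T * (a * law)) + a * ((4 / 3 : ℝ) * τ))) =
      2 * Γ * q * (a * law) + T / ν * (8 * a / 3 * τ) := by
    field_simp
    ring
  have e2 : 2 / ν * (ν / T * (a * law) + 2 * (Γ * q * (ν / T * (a * law)) + a * ((4 / 3 : ℝ) * τ))) =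
      2 / T * (a * law) + 4 * Γ * q / T * (a * law) + 2 / ν * (8 * a / 3 * τ) := by
    field_simp
    ring
  rw [e1] at p1
  rw [e2] at p2
  have hsum : T / ν + 2 / ν ≤ 1 := by
    rw [← add_div, div_le_one hν]; exact hTν
  have hc0 : 0 ≤ 8 * a / 3 * τ := by positivity
  have p4 : T / ν * (8 * a / 3 * τ) + 2 / ν * (8 * a / 3 * τ) ≤ 8 * a / 3 * τ := by
    calc T / ν * (8 * a / 3 * τ) + 2 / ν * (8 * a / 3 * τ) = (T / ν + 2 / ν) * (8 * a / 3 * τ) := by ring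
      _ ≤ 1 * (8 * a / 3 * τ) := mul_le_mul_of_nonneg_right hsum hc0
      _ = 8 * a / 3 * τ := one_mul _
  have efin : a * law * (4 * Γ * q + (2 + 4 * Γ * q) / T) + 16 * a / 3 * τ =
      2 * Γ * q * (a * law) + (2 / T * (a * law) + 4 * Γ * q / T * (a * law)) + 2 * Γ * q * (a * law) +
        (8 * a / 3 * τ + 8 * a / 3 * τ) := by
    field_simp
    ring
  rw [efin]
  linarith [p1, p2, p3, p4]

/-! ### §3 From the four-term form to `ε_A·A` -/

/-- **Relative form from the two floors**: if `V·law ≤ A` (`V > 0`, the variance floor) and `LB ≤ law` (`LB > 0`, the window floor),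
then for `λ, μ' ≥ 0`: `α·A + λ·law + μ' ≤ (α + λ/V + μ'/(LB·V))·A`. [cite: Rothvoss2017, §2 (PDF p. 6)] -/
theorem rel_of_floor {α lam μ' A law V LB : ℝ} (hV : 0 < V) (hLB : 0 < LB) (hVA : V * law ≤ A) (hLBl : LB ≤ law)
    (hlam : 0 ≤ lam) (hμ' : 0 ≤ μ') :
    α * A + lam * law + μ' ≤ (α + lam / V + μ' / (LB * V)) * A := by
  have h1 : lam * law ≤ lam / V * A := by
    rw [div_mul_eq_mul_div, le_div_iff₀ hV]
    calc lam * law * V = lam * (V * law) := by ring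
      _ ≤ lam * A := mul_le_mul_of_nonneg_left hVA hlam
  have h2 : μ' ≤ μ' / (LB * V) * A := by
    rw [div_mul_eq_mul_div, le_div_iff₀ (mul_pos hLB hV)]
    have : LB * V ≤ A := by nlinarith
    calc μ' * (LB * V) ≤ μ' * A := mul_le_mul_of_nonneg_left this hμ'
      _ = μ' * A := rfl
  nlinarith [h1, h2]

end Summit.PneNP.PneNP.Theorems.ChebyshevTracialDesignGammaDirectionSecondMomentRelativeFirst

end
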